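import Mathlib

/-!
# Advective head/tail split: the rigorous half of the certified-spectra price (P-CERT-X0 §3′)

HONEST FRAMING (cell `ns-blowup`, seat `ns-blowup-instab`, human ruling D-0035): nothing here is a
claim about Navier–Stokes blow-up. WHAT THIS IS NOT: not NS evidence; abstract real-Hilbert-space and
real-arithmetic lemmas that are the RIGOROUS steps (a), (d) of the cost revision
`instab/P-CERT-X0-PREREG.md` §3′ / `INSTAB-BRIDGE.md` §9 (2026-08-25, instab g6). The NEGATIVE half
of that revision (the advective two-way coupling `≈ aR/K` does not close below the advective range)
is operator-norm arithmetic and stays HEUR there; it is not asserted here.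

Dictionary. `E` = the div-free, symmetry-class-restricted `L²` space (or its Fourier tail
`|k|_∞ > K`); `B` = the (tail block of the) linearised operator `νPΔ − z − P(U·∇) − P[(·)·∇U]`, or
its advective part `S_z = νPΔ − z − P(U·∇)`; `A` = the advection `P(U·∇)`, which is SKEW on
div-free fields (`⟪A w, w⟫ = 0`); `D` = the dissipative remainder.

* `inner_add_skew` — a skew part does not change the quadratic form: `⟪(D + A) w, w⟫ = ⟪D w, w⟫`.
* `norm_le_of_coercive_neg` — if `⟪B w, w⟫ ≤ −m‖w‖²` with `m > 0` then `m‖w‖ ≤ ‖B w‖` for all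
  `w`: the resolvent LOWER BOUND behind «`‖T⁻¹‖ ≤ 1/m`» (tail, `m = ν(K+1)² − s_max − γ`) and
  «`‖S_z⁻¹‖ ≤ 1/Re z`» (global); `injective_of_coercive_neg`; `norm_rightInverse_le` — any right
  inverse is bounded by `1/m` (surjectivity itself is Lax–Milgram, Mathlib `IsCoercive`, not
  restated).
* `energy_consequences` — from the energy identity `ν g² + γ x² ≤ F x` (`x = ‖u‖`, `g = ‖∇u‖`,
  `F = ‖f‖`, obtained by pairing `S_z u = f` with `u` and using skewness): `x ≤ F/γ`,
  `g ≤ F/√(νγ)`, and for any quantity `q ≤ g/K'` (the Fourier tail, next item) `q ≤ F/(K'√(νγ))` —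
  the «`‖Q_K S_z⁻¹‖ ≤ 1/((K+1)√(ν Re z))`» H¹-gain tail estimate of §3′(d).
* `tail_sum_le_weighted` — the Parseval step: on the tail, where every weight is `≥ W`
  (`W = (K+1)²`), `Σ_tail a ≤ (Σ_all w·a)/W` for non-negative `a, w` (finite sums; the `ℓ²`
  statement is its monotone limit).

Mathlib only; no new definitions.
-/

namespace Summit.NavierStokesRegularity.FluidComputer.AdvectiveSplitBounds

section Hilbert

variable {E : Type*} [NormedAddCommGroup E] [InnerProductSpace ℝ E]

/-- **A skew part does not change the quadratic form**: if `⟪A w, w⟫ = 0` for all `w` then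
`⟪(D + A) w, w⟫ = ⟪D w, w⟫` — advection by a divergence-free field drops out of every energy
estimate, which is why the TAIL of the split stays coercive with the purely dissipative margin. -/
theorem inner_add_skew (D A : E →ₗ[ℝ] E) (hA : ∀ w : E, inner ℝ (A w) w = 0) (w : E) :
    inner ℝ ((D + A) w) w = inner ℝ (D w) w := by
  rw [LinearMap.add_apply, inner_add_left, hA, add_zero]

/-- **Coercivity ⇒ resolvent lower bound.** If `⟪B w, w⟫ ≤ −m‖w‖²` for every `w`, with `m > 0`,
then `m‖w‖ ≤ ‖B w‖` (no sign hypothesis on `m` is needed for this half). (With surjectivity — Lax–Milgram — this is `‖B⁻¹‖ ≤ 1/m`; used for the tail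
block, `m = ν(K+1)² − s_max − γ`, and for `S_z` globally, `m = Re z`.) -/
theorem norm_le_of_coercive_neg (B : E →ₗ[ℝ] E) {m : ℝ}
    (hB : ∀ w : E, inner ℝ (B w) w ≤ -(m * ‖w‖ ^ 2)) (w : E) : m * ‖w‖ ≤ ‖B w‖ := by
  by_cases hw : w = 0
  · simp [hw]
  have hpos : 0 < ‖w‖ := norm_pos_iff.mpr hw
  have h1 : m * ‖w‖ ^ 2 ≤ ‖B w‖ * ‖w‖ := by
    have hle := hB w
    have habs := abs_real_inner_le_norm (B w) w
    have hneg := neg_abs_le (inner ℝ (B w) w)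
    nlinarith
  nlinarith

/-- A coercive operator is injective. -/
theorem injective_of_coercive_neg (B : E →ₗ[ℝ] E) {m : ℝ} (hm : 0 < m)
    (hB : ∀ w : E, inner ℝ (B w) w ≤ -(m * ‖w‖ ^ 2)) : Function.Injective B := by
  rw [← LinearMap.ker_eq_bot, LinearMap.ker_eq_bot']
  intro w hw
  have h := norm_le_of_coercive_neg B hB w
  rw [hw, norm_zero] at h
  have : ‖w‖ ≤ 0 := by nlinarith
  exact norm_le_zero_iff.mp this

/-- **Any right inverse of a coercive operator is bounded by `1/m`**: if `B (S f) = f` for all `f`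
then `‖S f‖ ≤ ‖f‖ / m`. -/
theorem norm_rightInverse_le (B : E →ₗ[ℝ] E) {m : ℝ} (hm : 0 < m)
    (hB : ∀ w : E, inner ℝ (B w) w ≤ -(m * ‖w‖ ^ 2)) (S : E → E) (hS : ∀ f : E, B (S f) = f) (f : E) :
    ‖S f‖ ≤ ‖f‖ / m := by
  rw [le_div_iff₀ hm, mul_comm]
  have h := norm_le_of_coercive_neg B hB (S f)
  rwa [hS] at h

/-- The quadratic form of `S = D + A` with `A` skew and `D` dissipative with margin `m` is bounded by
`−m‖w‖²` — packaging `inner_add_skew` with a coercivity hypothesis on `D`. -/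
theorem coercive_neg_add_skew (D A : E →ₗ[ℝ] E) {m : ℝ} (hA : ∀ w : E, inner ℝ (A w) w = 0)
    (hD : ∀ w : E, inner ℝ (D w) w ≤ -(m * ‖w‖ ^ 2)) (w : E) :
    inner ℝ ((D + A) w) w ≤ -(m * ‖w‖ ^ 2) := by
  rw [inner_add_skew D A hA]; exact hD w

end Hilbert

/-! ## Energy identity ⇒ L², H¹ and tail bounds (§3′(d)) -/

section Energy

/-- **Consequences of the energy inequality** `ν g² + γ x² ≤ F x` (all quantities non-negative;
`x = ‖u‖`, `g = ‖∇u‖`, `F = ‖f‖` for `S_z u = f`, `γ = Re z`): the global resolvent bound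
`x ≤ F/γ`, the H¹ gain `g ≤ F/√(νγ)`, and for any `q` with `K' q ≤ g` (the Fourier tail beyond
`|k| = K'−1`, by `tail_sum_le_weighted`) the tail estimate `q ≤ F/(K' √(νγ))`. -/
theorem energy_consequences {ν γ K' x g F q : ℝ} (hν : 0 < ν) (hγ : 0 < γ) (hK : 0 < K')
    (hx : 0 ≤ x) (hg : 0 ≤ g) (hF : 0 ≤ F)
    (henergy : ν * g ^ 2 + γ * x ^ 2 ≤ F * x) (htail : K' * q ≤ g) :
    x ≤ F / γ ∧ g ≤ F / Real.sqrt (ν * γ) ∧ q ≤ F / (K' * Real.sqrt (ν * γ)) := by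
  have hνγ : 0 < ν * γ := mul_pos hν hγ
  have hs : 0 < Real.sqrt (ν * γ) := Real.sqrt_pos.mpr hνγ
  have hs2 : Real.sqrt (ν * γ) ^ 2 = ν * γ := Real.sq_sqrt hνγ.le
  -- L² bound: γ x² ≤ F x ⇒ γ x ≤ F
  have hγx : γ * x ≤ F := by
    by_cases hx0 : x = 0
    · rw [hx0, mul_zero]; exact hF
    · have hxpos : 0 < x := lt_of_le_of_ne hx (Ne.symm hx0)
      have h1 : γ * x ^ 2 ≤ F * x := by nlinarith [sq_nonneg g]
      have h2 : (γ * x) * x ≤ F * x := by nlinarith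
      exact le_of_mul_le_mul_right h2 hxpos
  have hx' : x ≤ F / γ := by rw [le_div_iff₀ hγ, mul_comm]; exact hγx
  -- H¹ bound: ν γ g² ≤ γ F x ≤ F²
  have hg2 : ν * γ * g ^ 2 ≤ F ^ 2 := by
    have h1 : ν * g ^ 2 ≤ F * x := by nlinarith [sq_nonneg x]
    have h2 : γ * (F * x) ≤ F ^ 2 := by
      have := mul_le_mul_of_nonneg_left hγx hF
      nlinarith
    nlinarith
  have hg' : g ≤ F / Real.sqrt (ν * γ) := by
    rw [le_div_iff₀ hs]
    have hsq : (g * Real.sqrt (ν * γ)) ^ 2 ≤ F ^ 2 := by rw [mul_pow, hs2]; nlinarith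
    exact (pow_le_pow_iff_left₀ (mul_nonneg hg hs.le) hF two_ne_zero).mp hsq
  refine ⟨hx', hg', ?_⟩
  rw [le_div_iff₀ (mul_pos hK hs)]
  have hgF : g * Real.sqrt (ν * γ) ≤ F := by rwa [le_div_iff₀ hs] at hg'
  calc q * (K' * Real.sqrt (ν * γ)) = (K' * q) * Real.sqrt (ν * γ) := by ring
    _ ≤ g * Real.sqrt (ν * γ) := mul_le_mul_of_nonneg_right htail hs.le
    _ ≤ F := hgF

end Energy

/-! ## The Parseval step: tail mass is controlled by the weighted (gradient) mass -/

section Tail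

/-- **Tail sum vs weighted sum.** For non-negative `a i`, `w i` on a finite index set, if every
index in the tail `T ⊆ S` has weight `w i ≥ W > 0` (Fourier: `w k = |k|²`, `W = (K+1)²` on
`|k|_∞ > K`), then `W · Σ_{T} a ≤ Σ_{S} w · a`, i.e. `‖Q_K u‖² ≤ ‖∇u‖² / (K+1)²`. -/
theorem tail_sum_le_weighted {ι : Type*} (S T : Finset ι) (hTS : T ⊆ S) (a w : ι → ℝ) {W : ℝ}
    (ha : ∀ i ∈ S, 0 ≤ a i) (hw : ∀ i ∈ S, 0 ≤ w i) (hW : ∀ i ∈ T, W ≤ w i) :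
    W * ∑ i ∈ T, a i ≤ ∑ i ∈ S, w i * a i := by
  calc W * ∑ i ∈ T, a i = ∑ i ∈ T, W * a i := by rw [Finset.mul_sum]
    _ ≤ ∑ i ∈ T, w i * a i := by
        apply Finset.sum_le_sum
        intro i hi
        exact mul_le_mul_of_nonneg_right (hW i hi) (ha i (hTS hi))
    _ ≤ ∑ i ∈ S, w i * a i := by
        apply Finset.sum_le_sum_of_subset_of_nonneg hTS
        intro i hi _
        exact mul_nonneg (hw i hi) (ha i hi)

end Tail

end Summit.NavierStokesRegularity.FluidComputer.AdvectiveSplitBounds
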